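import Summits.Ventures.YMGap.RobustBall.StringTensionSharp
import Summits.Ventures.YMGap.RobustBall.WilsonOneStateConfinement
import HarnessLib

/-!
# Robust ball (Y2), area-law side — WILSON'S STRONG-COUPLING LAW AS A LIMIT THEOREM: `σ(μ)/log(4/β_W) → 1` uniformly over states

HONEST FRAMING: venture file of the cell `pub-ymgap` (QuantumFields programme), track ROBUST-BALL, seat rb-p2 (g5).  LATTICE
statements about the infinite-volume limit states of the `SU(N)` torus Wilson states (tree coupling `β = β_W/N`), `d = 4`.
WHAT IS NEW — the sharp two-sided laws of `StringTensionSharp` rewritten as honest LIMIT statements (ε–β₀ form, uniform over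
all infinite-volume limit states, no state selection):
* ★★ `su2_stringTension_law_uniform_limit_dim4`: for every `ε > 0` there is `β₀ > 0` such that for all `0 < β_W ≤ β₀` and EVERY
  infinite-volume limit state `μ` at `β_W`: `|σ(μ)/log(4/β_W) − 1| ≤ ε` — i.e. `σ ~ log(4/β_W) = log(8/g²)` as `β_W = 4/g² → 0`,
  Wilson's 1974 strong-coupling law for the `SU(2)` string tension, as a theorem about the actual infinite-volume states;
* ★ `suN_stringTension_law_uniform_limit_dim4`: the same for every `SU(N)`, `N ≥ 2`: `σ(μ)/log(N/β) → 1` as `β → 0⁺`, uniformly;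
* ★★ `su2_oneState_law_dim4` (`0 < β_W ≤ 9/25`): ONE STATE, MASSIVE, CONFINING, OBEYING THE LAW — the infinite-volume limit states
  and the DLR states both reduce to a single `μ`, `MassGapAt 4 2 (β_W/4)`, `σ(μ)` exists and `|σ(μ) − log(4/β_W)| ≤ log 6 + 24β_W`
  (rb-p2 g3's `su2_oneState_massive_confining` joined with the sharp law).
WHAT IT IS NOT: `β₀(ε)` is explicit but not optimised (`β₀ = min(2/3, 4·exp(−(log 6 + 16)/ε))`); the `O(β_W²)` correction of the
character expansion is not claimed; nothing continuum / spectral / Clay.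

References: K. Wilson, Phys. Rev. D 10 (1974) 2445 §VI; M. Creutz, Phys. Rev. D 21 (1980) 2308 (for comparison only).  Everything here
is proved. [folklore]
-/

noncomputable section

open MeasureTheory Filter Topology
open Literature.MathematicalPhysics.QuantumLattice
open Literature.MathematicalPhysics.QuantumFieldTheory hiding ZdEdge Site

namespace Summit.Ventures.YMGap.RobustBall

namespace StringTensionExplicit

/-- Elementary: for `0 < x ≤ min(c, A·exp(−K/ε))` with `A > 0`: `K/ε ≤ log(A/x)`. [folklore] -/
theorem div_le_log_div_of_le_exp {x c A K ε : ℝ} (hx : 0 < x) (hA : 0 < A)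
    (hle : x ≤ min c (A * Real.exp (-(K / ε)))) : K / ε ≤ Real.log (A / x) := by
  have h1 : x ≤ A * Real.exp (-(K / ε)) := hle.trans (min_le_right _ _)
  have h2 : Real.exp (K / ε) ≤ A / x := by
    rw [le_div_iff₀ hx]
    calc Real.exp (K / ε) * x ≤ Real.exp (K / ε) * (A * Real.exp (-(K / ε))) :=
          mul_le_mul_of_nonneg_left h1 (Real.exp_pos _).le
      _ = A := by rw [Real.exp_neg]; field_simp
  calc K / ε = Real.log (Real.exp (K / ε)) := (Real.log_exp _).symm
    _ ≤ Real.log (A / x) := Real.log_le_log (Real.exp_pos _) h2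

/-- ★★ **WILSON'S STRONG-COUPLING LAW FOR THE SU(2) STRING TENSION AS A UNIFORM LIMIT** (`d = 4`): for every `ε > 0` there is
`β₀ > 0` such that for every Wilson coupling `0 < β_W ≤ β₀` and EVERY infinite-volume limit state `μ` of the torus Wilson states at
`β_W` (tree coupling `β_W/2`): `|σ(μ)/log(4/β_W) − 1| ≤ ε`. [folklore] -/
theorem su2_stringTension_law_uniform_limit_dim4 :
    ∀ ε : ℝ, 0 < ε → ∃ β₀ : ℝ, 0 < β₀ ∧ ∀ βW : ℝ, 0 < βW → βW ≤ β₀ →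
      ∀ μ ∈ infiniteVolumeLimitPoints (d := 4) (fundamentalRep (Fin 2)) (βW / 2),
        |stringTension μ (fun g => normalisedCharacter 2 (fundamentalRep (Fin 2) g)) / Real.log (4 / βW) - 1| ≤ ε := by
  intro ε hε
  refine ⟨min (2 / 3) (4 * Real.exp (-((Real.log 6 + 16) / ε))), lt_min (by norm_num) (by positivity), ?_⟩
  intro βW hβ hle μ hμ
  have hβ1 : βW ≤ 2 / 3 := hle.trans (min_le_left _ _)
  have h := su2_stringTension_div_log4_sub_one_abs_le_dim4 hβ hβ1 hμ
  have hL : 0 < Real.log (4 / βW) := Real.log_pos (by rw [lt_div_iff₀ hβ]; linarith)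
  have hK : (Real.log 6 + 16) / ε ≤ Real.log (4 / βW) := div_le_log_div_of_le_exp hβ (by norm_num) hle
  refine h.trans ?_
  rw [div_le_iff₀ hL]
  have h6 : 0 ≤ Real.log 6 := Real.log_nonneg (by norm_num)
  have hK' : Real.log 6 + 16 ≤ ε * Real.log (4 / βW) := by rwa [div_le_iff₀' hε] at hK
  nlinarith

/-- **Every `SU(N)`, `d = 4`, the law as a ratio**: for `N ≥ 2`, `0 < β ≤ N/24` and every infinite-volume limit state,
`|σ(μ)/log(N/β) − 1| ≤ (log 24 + 24Nβ)/log(N/β)` (`log(N/β) ≥ log 24 > 0`). [folklore] -/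
theorem suN_stringTension_div_log_sub_one_abs_le_dim4 {N : ℕ} (hN : 2 ≤ N) {β : ℝ} (hβ : 0 < β) (hβ1 : β ≤ N / 24)
    {μ : Measure (LGConfig 4 (SUN N))} (hμ : μ ∈ infiniteVolumeLimitPoints (fundamentalRep (Fin N)) β) :
    |stringTension μ (fun g => normalisedCharacter N (fundamentalRep (Fin N) g)) / Real.log (N / β) - 1| ≤
      (Real.log 24 + 24 * N * β) / Real.log (N / β) := by
  have hN0 : (0 : ℝ) < N := by exact_mod_cast (show 0 < N by omega)
  have hL : 0 < Real.log (N / β) := Real.log_pos (by rw [lt_div_iff₀ hβ]; linarith)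
  have h := suN_stringTension_sub_log_abs_le_dim4 hN hβ hβ1 hμ
  rw [show stringTension μ (fun g => normalisedCharacter N (fundamentalRep (Fin N) g)) / Real.log (N / β) - 1 =
      (stringTension μ (fun g => normalisedCharacter N (fundamentalRep (Fin N) g)) - Real.log (N / β)) / Real.log (N / β) by
    field_simp]
  rw [abs_div, abs_of_pos hL]
  exact div_le_div_of_nonneg_right h hL.le

/-- ★ **THE STRONG-COUPLING LAW FOR EVERY SU(N) AS A UNIFORM LIMIT** (`d = 4`, `N ≥ 2`): for every `ε > 0` there is `β₀ > 0`
such that for every tree coupling `0 < β ≤ β₀` and every infinite-volume limit state `μ` of the `SU(N)` torus Wilson states at `β`: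
`|σ(μ)/log(N/β) − 1| ≤ ε`. [folklore] -/
theorem suN_stringTension_law_uniform_limit_dim4 {N : ℕ} (hN : 2 ≤ N) :
    ∀ ε : ℝ, 0 < ε → ∃ β₀ : ℝ, 0 < β₀ ∧ ∀ β : ℝ, 0 < β → β ≤ β₀ →
      ∀ μ ∈ infiniteVolumeLimitPoints (d := 4) (fundamentalRep (Fin N)) β,
        |stringTension μ (fun g => normalisedCharacter N (fundamentalRep (Fin N) g)) / Real.log (N / β) - 1| ≤ ε := by
  intro ε hε
  have hN0 : (0 : ℝ) < N := by exact_mod_cast (show 0 < N by omega)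
  refine ⟨min (N / 24) (N * Real.exp (-((Real.log 24 + N ^ 2) / ε))), lt_min (by positivity) (by positivity), ?_⟩
  intro β hβ hle μ hμ
  have hβ1 : β ≤ N / 24 := hle.trans (min_le_left _ _)
  have h := suN_stringTension_div_log_sub_one_abs_le_dim4 hN hβ hβ1 hμ
  have hL : 0 < Real.log (N / β) := Real.log_pos (by rw [lt_div_iff₀ hβ]; linarith)
  have hK : (Real.log 24 + (N : ℝ) ^ 2) / ε ≤ Real.log (N / β) := div_le_log_div_of_le_exp hβ hN0 hle
  refine h.trans ?_
  rw [div_le_iff₀ hL]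
  have h24 : 0 ≤ Real.log 24 := Real.log_nonneg (by norm_num)
  have hK' : Real.log 24 + (N : ℝ) ^ 2 ≤ ε * Real.log (N / β) := by rwa [div_le_iff₀' hε] at hK
  have hNβ : 24 * (N : ℝ) * β ≤ (N : ℝ) ^ 2 := by
    have := mul_le_mul_of_nonneg_left hβ1 (by positivity : (0 : ℝ) ≤ 24 * N)
    nlinarith
  nlinarith

/-- ★★ **SU(2), `d = 4`, `0 < β_W ≤ 9/25`: ONE STATE, MASSIVE, CONFINING, OBEYING WILSON'S LAW.**  The infinite-volume limit states
of the torus Wilson states and the DLR (Gibbs) states both consist of ONE measure `μ`; the theory has a mass gap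
(`MassGapAt 4 2 (β_W/4)`); the string tension `σ(μ)` exists; and `|σ(μ) − log(4/β_W)| ≤ log 6 + 24β_W`. [folklore] -/
theorem su2_oneState_law_dim4 {βW : ℝ} (hβ : 0 < βW) (hle : βW ≤ 9 / 25) :
    ∃ μ : Measure (LGConfig 4 (SUN 2)),
      infiniteVolumeLimitPoints (d := 4) (fundamentalRep (Fin 2)) (βW / 2) = {μ} ∧
      ymGibbsMeasures (d := 4) (fundamentalRep (Fin 2)) (βW / 2) = {μ} ∧
      MassGapAt 4 2 (βW / 4) ∧
      HasStringTension μ (fun g => normalisedCharacter 2 (fundamentalRep (Fin 2) g))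
        (stringTension μ (fun g => normalisedCharacter 2 (fundamentalRep (Fin 2) g))) ∧
      |stringTension μ (fun g => normalisedCharacter 2 (fundamentalRep (Fin 2) g)) - Real.log (4 / βW)| ≤
        Real.log 6 + 24 * βW := by
  obtain ⟨μ, -, hpts, hG, hgap, -⟩ := WilsonStringTension.su2_oneState_massive_confining hβ hle
  have hμ : μ ∈ infiniteVolumeLimitPoints (d := 4) (fundamentalRep (Fin 2)) (βW / 2) := by
    rw [hpts]; exact Set.mem_singleton μ
  have hβ1 : βW ≤ 2 / 3 := by linarith
  obtain ⟨hσ, -⟩ := su2_stringTension_ge_log_dim4 hβ hβ1 hμ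
  exact ⟨μ, hpts, hG, hgap, hσ, su2_stringTension_sub_log4_abs_le_dim4 hβ hβ1 hμ⟩

end StringTensionExplicit

end Summit.Ventures.YMGap.RobustBall
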